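import Literature.Geometry.GeometricMeasureTheory.Currents
import HarnessLib

/-!
# Restricting currents to smaller open sets

For open sets `Ω' ≤ Ω` of a real normed space, Mathlib's continuous inclusion of test functions
`TestFunction.monoCLM ℝ : 𝓓(Ω', F) →L[ℝ] 𝓓(Ω, F)` (extension by zero of the SAME function)
restricts currents: `T ↦ T ∘L monoCLM`, Federer's `T|Ω'` ("if `V` is an open subset of `U`, then
each `T ∈ 𝒟_m(U)` has a restriction `T|V ∈ 𝒟_m(V)`", [Federer1969, 4.1.7]). Proved here:

* `TestForm.monoCLM_apply_of_le`, `TestForm.extDerivCLM_monoCLM` — the inclusion is the identity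
  on underlying functions and commutes with `d`;
* `Current.boundary_comp_monoCLM` — **`∂(T|Ω') = (∂T)|Ω'`**;
* `vectorCurrent_eq_comp_monoCLM`, `currentOfIntegration_eq_comp_monoCLM` — for locally
  `μ`-integrable `η` on `Ω`, the current `μ ∧ η` (resp. `[W, θ, ξ]`) formed on `Ω'` IS the
  restriction of the one formed on `Ω` (same integral; both honest);
* `currentOfIntegration_boundary_eq_zero_of_le` — hence a current of integration that is a cycle
  on `Ω` is a cycle on every `Ω' ≤ Ω`.

No definitions (the restriction is written `T.comp (TestFunction.monoCLM ℝ)`), no named facts.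

## References

* H. Federer, *Geometric Measure Theory*, Springer 1969, 4.1.7 [Federer1969].
-/

open scoped Distributions ENNReal NNReal Topology
open MeasureTheory TopologicalSpace Set Filter

namespace Literature.Geometry.GeometricMeasureTheory

-- Nested operator-norm instances on (duals of) `E [⋀^Fin m]→L[ℝ] ℝ`, as in `Currents.lean`.
set_option maxSynthPendingDepth 2

variable {E : Type*} [NormedAddCommGroup E] [NormedSpace ℝ E] {Ω' Ω : Opens E} {m : ℕ}

/-! ### The inclusion of test forms and the exterior derivative -/

/-- For `Ω' ≤ Ω` the inclusion `monoCLM` does not change the underlying function.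
[cite: Federer1969, 4.1.7] -/
theorem TestForm.monoCLM_apply_of_le (hle : Ω' ≤ Ω) (φ : TestForm Ω' m) :
    ⇑(TestFunction.monoCLM ℝ φ : TestForm Ω m) = ⇑φ := by
  rw [TestFunction.monoCLM_apply, if_pos ⟨le_rfl, hle⟩]

/-- The inclusion `𝒟^m(Ω') → 𝒟^m(Ω)` commutes with `d`. [cite: Federer1969, 4.1.7] -/
theorem TestForm.extDerivCLM_monoCLM (hle : Ω' ≤ Ω) (φ : TestForm Ω' m) :
    TestForm.extDerivCLM (TestFunction.monoCLM ℝ φ : TestForm Ω m) =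
      TestFunction.monoCLM ℝ (TestForm.extDerivCLM φ) := by
  apply TestFunction.ext
  intro x
  have h1 := congrFun (TestForm.extDerivCLM_apply (TestFunction.monoCLM ℝ φ : TestForm Ω m)) x
  have h2 := congrFun (TestForm.extDerivCLM_apply φ) x
  rw [h1, TestForm.monoCLM_apply_of_le hle, TestForm.monoCLM_apply_of_le hle, h2]

/-- **`∂(T|Ω') = (∂T)|Ω'`**: restriction to a smaller open set commutes with the boundary
operator. [cite: Federer1969, 4.1.7] -/
theorem Current.boundary_comp_monoCLM (hle : Ω' ≤ Ω) (T : Current Ω (m + 1)) :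
    Current.boundary (T.comp (TestFunction.monoCLM ℝ) : Current Ω' (m + 1)) =
      T.boundary.comp (TestFunction.monoCLM ℝ) := by
  ext φ
  rw [Current.boundary_apply, ContinuousLinearMap.comp_apply, ContinuousLinearMap.comp_apply,
    Current.boundary_apply, TestForm.extDerivCLM_monoCLM hle]

/-! ### Currents representable by integration on `Ω' ≤ Ω` -/

variable [MeasurableSpace E] [OpensMeasurableSpace E]

/-- For `η` locally `μ`-integrable on `Ω` and `Ω' ≤ Ω`, the current `μ ∧ η` formed on `Ω'` is the
restriction of `μ ∧ η` formed on `Ω` (both are the honest integral `φ ↦ ∫ ⟨φ, η⟩ dμ`).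
[cite: Federer1969, 4.1.7] -/
theorem vectorCurrent_eq_comp_monoCLM (hle : Ω' ≤ Ω) {μ : Measure E} {η : E → Multivector E m}
    (hη : LocallyIntegrableOn η (Ω : Set E) μ) :
    (vectorCurrent μ η : Current Ω' m) = (vectorCurrent μ η : Current Ω m).comp
      (TestFunction.monoCLM ℝ) := by
  have hη' : LocallyIntegrableOn η (Ω' : Set E) μ := hη.mono_set hle
  ext φ
  rw [ContinuousLinearMap.comp_apply, vectorCurrent_apply hη', vectorCurrent_apply hη]
  refine integral_congr_ae (Eventually.of_forall fun x => ?_)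
  simp only [TestForm.monoCLM_apply_of_le hle]

section Integration

variable {V : Type*} [NormedAddCommGroup V] [NormedSpace ℝ V] [MeasurableSpace V] [BorelSpace V]
  {Ω' Ω : Opens V} {m : ℕ}

/-- For locally summable data on `Ω` and `Ω' ≤ Ω`, the current of integration `[W, θ, ξ]` formed
on `Ω'` is the restriction of `[W, θ, ξ]` formed on `Ω`. [cite: Federer1969, 4.1.7] -/
theorem currentOfIntegration_eq_comp_monoCLM (hle : Ω' ≤ Ω) {W : Set V} {θ : V → ℤ}
    {ξ : V → Fin m → V}
    (h : LocallyIntegrableOn (fun x => (θ x : ℝ) • frameVector (ξ x)) (Ω : Set V)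
      ((μHE[m] : Measure V).restrict W)) :
    (currentOfIntegration W θ ξ : Current Ω' m) =
      (currentOfIntegration W θ ξ : Current Ω m).comp (TestFunction.monoCLM ℝ) :=
  vectorCurrent_eq_comp_monoCLM hle h

/-- **A cycle stays a cycle on smaller open sets**: if the current of integration `[W, θ, ξ]`
(locally summable data of dimension `m + 1` on `Ω`) has `∂[W, θ, ξ] = 0` on `Ω`, then
`∂[W, θ, ξ] = 0` on every `Ω' ≤ Ω`. [cite: Federer1969, 4.1.7] -/
theorem currentOfIntegration_boundary_eq_zero_of_le (hle : Ω' ≤ Ω) {W : Set V} {θ : V → ℤ}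
    {ξ : V → Fin (m + 1) → V}
    (h : LocallyIntegrableOn (fun x => (θ x : ℝ) • frameVector (ξ x)) (Ω : Set V)
      ((μHE[m + 1] : Measure V).restrict W))
    (h0 : (currentOfIntegration W θ ξ : Current Ω (m + 1)).boundary = 0) :
    (currentOfIntegration W θ ξ : Current Ω' (m + 1)).boundary = 0 := by
  rw [currentOfIntegration_eq_comp_monoCLM hle h, Current.boundary_comp_monoCLM hle, h0,
    ContinuousLinearMap.zero_comp]

end Integration

end Literature.Geometry.GeometricMeasureTheory
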